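import Summits.BirchSwinnertonDyer.BirchSwinnertonDyer.Theorems.AdditiveKolyvaginRoadKolyvaginVisibilityAtP
import Summits.BirchSwinnertonDyer.BirchSwinnertonDyer.Theorems.AdditiveKolyvaginRoadOnePlaceLagrangian
import Literature.NumberTheory.EllipticCurves.HeegnerPointsKolyvaginEulerSystem
import Summits.BirchSwinnertonDyer.BirchSwinnertonDyer.Theorems.SchneiderFreeAdditiveX3PoitouTateSelmerDualityHolds
import HarnessLib

/-!
# Route `AdditiveKolyvaginRoad`, crux KS′ `LevelKolyvaginSystemsAdditive` (item stmt-BirchSwinnertonDyer-21396) ∕ KPA′ (21400):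
# VISIBILITY AT `p` OF KOLYVAGIN CLASSES, MODULO THE NAMED DUALITY FACT — the visible partner from Poitou–Tate, the lever modulo DUAL.2,
# and the lever for Gross's Kolyvagin classes `c(n)` of a Heegner point
# (cell `pub/bsd-wall`, width seat `bsd-wall-akr-p2x-w3` g9; `--supports stmt-BirchSwinnertonDyer-21396`, helper; sequel of
# `…KolyvaginVisibilityStep.lean` ∕ `…KolyvaginVisibilityAtP.lean`, E-side engine for the crux-idea `visible-vertex-transfer`)

WHY. `exists_not_mem_torsionLocalKer_above_of_kolyvaginFamily` (previous file) makes a class of a Gross–Kolyvagin family visible above `p` GIVEN one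
`p`-relaxed visible eigen-partner `r`.  THIS FILE supplies the partner from the route's named duality fact DUAL.2 (`poitouTate_selmerStructure_duality K`,
via the tree's jump `exists_mem_kummerOutside_single_notMem_torsionLocalKer_of_dvd` at one relaxed place above `p`, akr-p2x) and states the lever in
the two consumer forms: for an abstract family modulo DUAL.2, and for Gross's printed classes `c(n)` of a Heegner point `y_K ∉ pE(K)` modulo
{`Gross1991_kolyvaginClasses`, DUAL.2} — «if the avatar's Heegner point is not `p`-divisible, some Kolyvagin class of conductor ≤ two primes is
`𝔭`-visible», which is what the card's derived Kriz–Li congruence DKL_n (unprinted, not here) wants to read.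

WHAT (namespace `…Theorems.AdditiveKoly`).
* `exists_eigen_partner_detected_of_poitouTate` — `K` imaginary quadratic, `p` odd, `v₀ ∋ p`: modulo DUAL.2 an eigenclass `r` (some sign) Kummer at
  `∞` and off `{v₀, c • v₀}`, detected at `v₀` (jump at `v₀` + eigen-splitting `x ± c_* x`, `2` invertible; transport `conjAct_mem_selmerLocalKer_iff`).
* `exists_not_mem_torsionLocalKer_above_of_kolyvaginFamily_of_poitouTate` — the lever for an abstract Gross–Kolyvagin family with `cl 1 ≠ 0`,
  modulo DUAL.2: some `cl n` (`n ∈ {1, ℓ, ℓ₁ℓ₂}`, Zhang–Kolyvagin support avoiding `T`) is detected at `v₀` or at `c • v₀`.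
* `exists_grossKolyvaginClass_detected_above_of_facts` — the same for Gross's classes of a Heegner point `P = y_K` with `¬ ∃ Q, pQ = P`, modulo
  `Gross1991_kolyvaginClasses N_E W K` (a leaf of the route's `kolyvagin`) and DUAL.2; frame `ρ̄_{E,p}` onto, `d_K < −4`, Heegner hypothesis.

HONEST FRAMING: theorems only; 0 definitions, 0 named facts minted, 0 `sorry`; the last two theorems are CONDITIONAL on the displayed named facts
(hypotheses).  Any reduction type of `E` at `p`.  Closes nothing.  BSD is not proved by any of this; KS′ ∕ KPA′ stay OPEN at `p² ∣ N`; the card's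
input DKL_n is untouched.

ADDENDUM (same seat, appended): DUAL.2 is a THEOREM in the tree (`SchneiderFreeAdditiveX3.PoitouTateReduction.poitouTate_selmerStructure_duality_holds`,
cell bsd-schneider, p624636), so §5 records the INPUT-FREE forms: the partner (`exists_eigen_partner_detected`), the lever for an abstract family
(`exists_not_mem_torsionLocalKer_above_of_kolyvaginFamily_free` — NO named fact), and the lever for Gross's classes modulo `Gross1991_kolyvaginClasses`
ALONE (`exists_grossKolyvaginClass_detected_above_of_grossClasses`).

References: [cite: GrossLMS1991, §4 (4.4), Prop. 5.4, Prop. 6.2, §9] [cite: McCallumLMS1991, §3 Cor. 3.2] [cite: MilneADT2006, Ch. I, Thm. 2.8,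
Thm. 4.10] [cite: Howard2004HeegnerKolyvagin, Thm. 2.1.11].
-/

set_option linter.dupNamespace false -- single-conjunct summit repeats the name by design

noncomputable section

open scoped Classical Pointwise

namespace Summit.BirchSwinnertonDyer.BirchSwinnertonDyer.Theorems.AdditiveKoly

open CategoryTheory WeierstrassCurve Field Function NumberField IsDedekindDomain
open Literature.NumberTheory.Automorphic
open Literature.NumberTheory.EllipticCurves Literature.NumberTheory.EllipticCurves.ModularForms
  Literature.NumberTheory.GaloisRepresentations Module
open Literature.NumberTheory.GaloisCohomology
open Summit.BirchSwinnertonDyer.Rank1Residual.X11b.Three.Koly.Method2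
open scoped ContRepresentation

/-! ## §4 The partner from Poitou–Tate; the lever modulo the named duality fact; the lever for Gross's classes -/

section Supply

variable (W : WeierstrassCurve ℚ) (K : Type) [Field K] [NumberField K] (p : ℕ) [Fact p.Prime] (c : K ≃ₐ[ℚ] K)

/-- **The visible `p`-relaxed eigen-partner, from Poitou–Tate.** Frame: `K` imaginary quadratic, `p` odd; `v₀` a place above `p`.  GRANTED the named
fact `poitouTate_selmerStructure_duality K` (the route's DUAL.2), there is an eigenclass `r ∈ H¹(K, E[p])` of complex conjugation (of SOME sign `s`)
satisfying E's Kummer condition at the infinite places and at every finite place off `{v₀, c • v₀}`, with NON-ZERO localisation at `v₀`.  Proof: the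
tree's `exists_mem_kummerOutside_single_notMem_torsionLocalKer_of_dvd` (Poitou–Tate exactness for the Kummer structure relaxed at `v₀`: the jump
`#Λ_{v₀} = #E(K_{v₀})[p] · #(𝓞_{v₀} ⧸ p) > 1`) gives a `v₀`-relaxed class `x` detected at `v₀`; its eigen-components `x ± c_* x` are Kummer off
`{v₀, c • v₀}` (transport `conjAct_mem_selmerLocalKer_iff`; complex places carry no condition) and one of them is detected at `v₀` (`2` is invertible on
`H¹(K, E[p])`). [cite: MilneADT2006, Ch. I, Thm. 2.8, Thm. 4.10] [cite: GrossLMS1991, §5 (5.1)] -/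
theorem exists_eigen_partner_detected_of_poitouTate [W.IsElliptic] (hK : IsImaginaryQuadratic K) (hp2 : p ≠ 2)
    (hPT : poitouTate_selmerStructure_duality K) (v₀ : HeightOneSpectrum (𝓞 K)) (hpv₀ : ((p : ℕ) : 𝓞 K) ∈ v₀.asIdeal) :
    ∃ (s : Bool) (r : Vp W K p), conjAct W c ((p ^ 1 : ℕ) : ℤ) r = sgnP s • r ∧
      (∀ w : InfinitePlace K, r ∈ selmerLocalKer (W.baseChange K) w.Completion ((p ^ 1 : ℕ) : ℤ)) ∧
      (∀ v : HeightOneSpectrum (𝓞 K), v ∉ ({v₀, c • v₀} : Finset (HeightOneSpectrum (𝓞 K))) →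
        r ∈ selmerLocalKer (W.baseChange K) (v.adicCompletion K) ((p ^ 1 : ℕ) : ℤ)) ∧
      r ∉ (W.baseChange K).torsionLocalKer (v₀.adicCompletion K) ((p ^ 1 : ℕ) : ℤ) := by
  have hp : p.Prime := Fact.out
  haveI : IsTotallyComplex K := hK.2
  obtain ⟨x₀, hx₀, hx₀0⟩ := exists_mem_kummerOutside_single_notMem_torsionLocalKer_of_dvd W K p hK hPT v₀ hpv₀
  -- the same class, typed in the carrier `Vp W K p = H¹(K, E[p])`
  have hxV : ∃ x : Vp W K p, x ∈ kummerOutside (W.baseChange K) (p ^ 1) ({Sum.inr v₀} : Finset (Place K)) ∧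
      x ∉ (W.baseChange K).torsionLocalKer (v₀.adicCompletion K) ((p ^ 1 : ℕ) : ℤ) := ⟨x₀, hx₀, hx₀0⟩
  obtain ⟨x, hx, hx0⟩ := hxV
  -- `x` satisfies E's Kummer condition at every place other than `v₀`
  have hxK : ∀ w : Place K, w ≠ Sum.inr v₀ →
      x ∈ selmerLocalKer (W.baseChange K) (Place.Completion w) ((p ^ 1 : ℕ) : ℤ) := by
    intro w hw
    rw [← comap_localization_kummerSelmerStructure]
    exact (mem_kummerOutside_iff (W.baseChange K) (p ^ 1) _ x).mp hx w (by rwa [Finset.mem_singleton])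
  have hxfin : ∀ v : HeightOneSpectrum (𝓞 K), v ≠ v₀ →
      x ∈ selmerLocalKer (W.baseChange K) (v.adicCompletion K) ((p ^ 1 : ℕ) : ℤ) :=
    fun v hv ↦ hxK (Sum.inr v) (fun h ↦ hv (Sum.inr_injective h))
  -- complex places carry no condition
  have hinfty : ∀ (z : Vp W K p) (w : InfinitePlace K), z ∈ selmerLocalKer (W.baseChange K) w.Completion ((p ^ 1 : ℕ) : ℤ) := by
    intro z w
    haveI : IsAlgClosed w.Completion :=
      isAlgClosed_of_ringEquiv (InfinitePlace.Completion.ringEquivComplexOfIsComplex (IsTotallyComplex.isComplex w)).symm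
    rw [WeierstrassCurve.selmerLocalKer_eq_top_of_isAlgClosed]
    trivial
  -- the conjugate class is Kummer at every finite place other than `c • v₀`
  have hτfin : ∀ v : HeightOneSpectrum (𝓞 K), v ≠ c • v₀ →
      conjAct W c ((p ^ 1 : ℕ) : ℤ) x ∈ selmerLocalKer (W.baseChange K) (v.adicCompletion K) ((p ^ 1 : ℕ) : ℤ) := by
    intro v hv
    have h0 : c • (c⁻¹ • v) = v := smul_inv_smul c v
    have hv' : c⁻¹ • v ≠ v₀ := fun h ↦ hv (by rw [← h, h0])
    haveI : CharZero ((c⁻¹ • v).adicCompletion K) := charZero_of_injective_algebraMap (algebraMap K _).injective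
    haveI : CharZero (v.adicCompletion K) := charZero_of_injective_algebraMap (algebraMap K _).injective
    exact (conjAct_mem_selmerLocalKer_iff W c (galAdicCompletionEquiv (L := K) c h0)
      (isSemilinearRingEquiv_galAdicCompletionEquiv c h0) _ x).mpr (hxfin _ hv')
  -- eigen-components
  have hcc : c * c = 1 := algEquiv_mul_self_eq_one K hK c
  have hττ : ∀ z, conjAct W c ((p ^ 1 : ℕ) : ℤ) (conjAct W c ((p ^ 1 : ℕ) : ℤ) z) = z :=
    conjAct_conjAct_of_mul_self W hcc ((p ^ 1 : ℕ) : ℤ)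
  obtain ⟨u, hu⟩ := exists_two_mul_zsmul_eq_of_odd W K p (hp.odd_of_ne_two hp2)
  set xp := x + conjAct W c ((p ^ 1 : ℕ) : ℤ) x with hxp
  set xm := x - conjAct W c ((p ^ 1 : ℕ) : ℤ) x with hxm
  have hs1 : sgnP true = 1 := by simp [sgnP]
  have hs2 : sgnP false = -1 := by simp [sgnP]
  have hτp : conjAct W c ((p ^ 1 : ℕ) : ℤ) xp = sgnP true • xp := by
    rw [hs1, one_zsmul, hxp, map_add, hττ, add_comm]
  have hτm : conjAct W c ((p ^ 1 : ℕ) : ℤ) xm = sgnP false • xm := by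
    rw [hs2, neg_one_zsmul, hxm, map_sub, hττ, neg_sub]
  have hoff : ∀ v : HeightOneSpectrum (𝓞 K), v ∉ ({v₀, c • v₀} : Finset (HeightOneSpectrum (𝓞 K))) → v ≠ v₀ ∧ v ≠ c • v₀ := by
    intro v hv
    rw [Finset.mem_insert, Finset.mem_singleton, not_or] at hv
    exact hv
  have hpK : ∀ v : HeightOneSpectrum (𝓞 K), v ∉ ({v₀, c • v₀} : Finset (HeightOneSpectrum (𝓞 K))) →
      xp ∈ selmerLocalKer (W.baseChange K) (v.adicCompletion K) ((p ^ 1 : ℕ) : ℤ) := fun v hv ↦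
    add_mem (hxfin v (hoff v hv).1) (hτfin v (hoff v hv).2)
  have hmK : ∀ v : HeightOneSpectrum (𝓞 K), v ∉ ({v₀, c • v₀} : Finset (HeightOneSpectrum (𝓞 K))) →
      xm ∈ selmerLocalKer (W.baseChange K) (v.adicCompletion K) ((p ^ 1 : ℕ) : ℤ) := fun v hv ↦
    sub_mem (hxfin v (hoff v hv).1) (hτfin v (hoff v hv).2)
  -- one of the two components is detected at `v₀`
  by_cases hp0 : xp ∈ (W.baseChange K).torsionLocalKer (v₀.adicCompletion K) ((p ^ 1 : ℕ) : ℤ)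
  · by_cases hm0 : xm ∈ (W.baseChange K).torsionLocalKer (v₀.adicCompletion K) ((p ^ 1 : ℕ) : ℤ)
    · exfalso
      apply hx0
      have hsum : xp + xm = (2 : ℤ) • x := by rw [hxp, hxm, two_zsmul]; abel
      have hx2 : x = u • (xp + xm) := by rw [hsum, ← mul_zsmul, mul_comm, hu]
      rw [hx2]
      exact AddSubgroup.zsmul_mem _ (add_mem hp0 hm0) _
    · exact ⟨false, xm, hτm, hinfty xm, hmK, hm0⟩
  · exact ⟨true, xp, hτp, hinfty xp, hpK, hp0⟩

variable [W.IsElliptic] [W.IsGloballyMinimal] [NeZero (W.conductorNorm ℤ)]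

/-- **THE LEVER MODULO DUAL.2.** Frame: `K` imaginary quadratic, `p` odd, `ρ̄_{E,p}` onto, `c ≠ 1` (any reduction type at `p`); `cl` a family
with Gross's three properties on square-free products of Zhang–Kolyvagin primes (as in `exists_not_mem_torsionLocalKer_above_of_kolyvaginFamily`)
and `cl 1 ≠ 0`.  GRANTED `poitouTate_selmerStructure_duality K`: for every place `v₀ ∋ p` some `cl n` — `n ∈ {1, ℓ, ℓ₁ℓ₂}` square-free of
Zhang–Kolyvagin support avoiding the finite `T` — has non-zero localisation at `v₀` or at `c • v₀` (so at a place above `p`).  = the previous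
theorem with the partner supplied by `exists_eigen_partner_detected_of_poitouTate`, `Σ = {v₀, c • v₀}`. CONDITIONAL on the named PT fact.
[cite: GrossLMS1991, Prop. 5.4, Prop. 6.2, §9] [cite: McCallumLMS1991, §3 Cor. 3.2] [cite: MilneADT2006, Ch. I, Thm. 4.10] -/
theorem exists_not_mem_torsionLocalKer_above_of_kolyvaginFamily_of_poitouTate (hK : IsImaginaryQuadratic K) (hp2 : p ≠ 2)
    (hsurj : W.HasSurjectiveModNGaloisRep p) (hc : c ≠ 1) (hPT : poitouTate_selmerStructure_duality K)
    (cl : ℕ → Vp W K p) (ε : ℤ) (hε : ε = 1 ∨ ε = -1)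
    (hsign : ∀ n : ℕ, Squarefree n → (∀ q ∈ n.primeFactors, Zhang2014.IsKolyvaginPrime (W.conductorNorm ℤ) W K p q) →
      conjAct W c ((p ^ 1 : ℕ) : ℤ) (cl n) = (ε * (-1) ^ n.primeFactors.card) • cl n)
    (hfin : ∀ n : ℕ, Squarefree n → (∀ q ∈ n.primeFactors, Zhang2014.IsKolyvaginPrime (W.conductorNorm ℤ) W K p q) →
      ∀ v : HeightOneSpectrum (𝓞 K), (n : 𝓞 K) ∉ v.asIdeal →
        cl n ∈ selmerLocalKer (W.baseChange K) (v.adicCompletion K) ((p ^ 1 : ℕ) : ℤ))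
    (hinf : ∀ n : ℕ, Squarefree n → (∀ q ∈ n.primeFactors, Zhang2014.IsKolyvaginPrime (W.conductorNorm ℤ) W K p q) →
      ∀ w : InfinitePlace K, cl n ∈ selmerLocalKer (W.baseChange K) w.Completion ((p ^ 1 : ℕ) : ℤ))
    (hrel : ∀ n : ℕ, Squarefree n → (∀ q ∈ n.primeFactors, Zhang2014.IsKolyvaginPrime (W.conductorNorm ℤ) W K p q) →
      ∀ ℓ : ℕ, ℓ.Prime → ℓ ∣ n → ∀ v : HeightOneSpectrum (𝓞 K), (ℓ : 𝓞 K) ∈ v.asIdeal →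
        (cl n ∈ selmerLocalKer (W.baseChange K) (v.adicCompletion K) ((p ^ 1 : ℕ) : ℤ) ↔
          cl (n / ℓ) ∈ (W.baseChange K).torsionLocalKer (v.adicCompletion K) ((p ^ 1 : ℕ) : ℤ)))
    (h1 : cl 1 ≠ 0) (v₀ : HeightOneSpectrum (𝓞 K)) (hpv₀ : ((p : ℕ) : 𝓞 K) ∈ v₀.asIdeal)
    (T : Finset {ℓ // Zhang2014.IsKolyvaginPrime (W.conductorNorm ℤ) W K p ℓ}) :
    ∃ n : ℕ, Squarefree n ∧ (∀ q ∈ n.primeFactors, Zhang2014.IsKolyvaginPrime (W.conductorNorm ℤ) W K p q) ∧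
      (∀ q ∈ n.primeFactors, ∀ ℓ ∈ T, (ℓ : ℕ) ≠ q) ∧ n.primeFactors.card ≤ 2 ∧
      ∃ w ∈ ({v₀, c • v₀} : Finset (HeightOneSpectrum (𝓞 K))), ((p : ℕ) : 𝓞 K) ∈ w.asIdeal ∧
        cl n ∉ (W.baseChange K).torsionLocalKer (w.adicCompletion K) ((p ^ 1 : ℕ) : ℤ) := by
  obtain ⟨s, r, hrs, hrinf, hrfin, hr0⟩ := exists_eigen_partner_detected_of_poitouTate W K p c hK hp2 hPT v₀ hpv₀
  -- both places of `Σ = {v₀, c • v₀}` lie above `p`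
  have hSig : ∀ v ∈ ({v₀, c • v₀} : Finset (HeightOneSpectrum (𝓞 K))), ((p : ℕ) : 𝓞 K) ∈ v.asIdeal := by
    intro v hv
    rw [Finset.mem_insert, Finset.mem_singleton] at hv
    rcases hv with rfl | rfl
    · exact hpv₀
    · have hq : c • ((p : ℕ) : 𝓞 K) = ((p : ℕ) : 𝓞 K) := map_natCast (MulSemiringAction.toRingHom (K ≃ₐ[ℚ] K) (𝓞 K) c) p
      rw [← HeightOneSpectrum.smul_mem_smul_asIdeal_iff c v₀ ((p : ℕ) : 𝓞 K), hq] at hpv₀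
      exact hpv₀
  obtain ⟨n, hsq, hKP, hT, hcard, w, hw, hwn⟩ := exists_not_mem_torsionLocalKer_above_of_kolyvaginFamily W K p c hK hp2 hsurj hc cl ε hε
    hsign hfin hinf hrel h1 {v₀, c • v₀} hSig s r hrs hrinf hrfin (Finset.mem_insert_self _ _) hr0 T
  exact ⟨n, hsq, hKP, hT, hcard, w, hw, hSig w hw, hwn⟩

/-- **THE LEVER FOR GROSS'S KOLYVAGIN CLASSES** (consumer form for the card `visible-vertex-transfer`).  Frame: `E/ℚ` elliptic with `ρ̄_{E,p}` onto
(`p` odd), `K` imaginary quadratic with `d_K < −4` satisfying the Heegner hypothesis for `N_E`, `P = y_K` a Heegner point (`IsHeegnerPoint`), `c ≠ 1`,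
`v₀` a place above `p`.  GRANTED the named facts `Gross1991_kolyvaginClasses N_E W K` (Gross 1991 §§3–6: Kolyvagin's classes `c(n)` with `c(1) = δ y_K`,
their signs, local conditions and (8.1) — a leaf of the route's `kolyvagin`) and `poitouTate_selmerStructure_duality K` (DUAL.2): if `y_K ∉ pE(K)`
then Gross's family — recorded with its printed properties at the level `p¹` of the carrier — has a member `c(n)`, `n ∈ {1, ℓ, ℓ₁ℓ₂}` square-free of
Zhang–Kolyvagin support avoiding `T`, with NON-ZERO localisation at a place above `p` (`𝔭`-visible).  The level-`p¹` primality witness `hp1` is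
`Fact p.Prime` respelled (`by rw [pow_one]; exact Fact.out`).  CONDITIONAL on the two named facts; any reduction type of `E` at `p`.
[cite: GrossLMS1991, §4 (4.4), Prop. 5.4, Prop. 6.2, Prop. 8.2, §9] [cite: McCallumLMS1991, §3 Cor. 3.2] [cite: MilneADT2006, Ch. I, Thm. 4.10] -/
theorem exists_grossKolyvaginClass_detected_above_of_facts (hGr : Gross1991_kolyvaginClasses (W.conductorNorm ℤ) W K)
    (hPT : poitouTate_selmerStructure_duality K) (hK : IsImaginaryQuadratic K) (hd : NumberField.discr K < -4)
    (hH : SatisfiesHeegnerHypothesis (W.conductorNorm ℤ) K) {P : (W.baseChange K).toAffine.Point}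
    (hP : IsHeegnerPoint (W.conductorNorm ℤ) W K P) (hp1 : Nat.Prime (p ^ 1)) (hp2 : p ≠ 2) (hsurj : W.HasSurjectiveModNGaloisRep p)
    (hc : c ≠ 1) (hdiv : ¬ ∃ Q : (W.baseChange K).toAffine.Point, p • Q = P)
    (v₀ : HeightOneSpectrum (𝓞 K)) (hpv₀ : ((p : ℕ) : 𝓞 K) ∈ v₀.asIdeal)
    (T : Finset {ℓ // Zhang2014.IsKolyvaginPrime (W.conductorNorm ℤ) W K p ℓ}) :
    ∃ (ε : ℤ) (cl : ℕ → Vp W K p), (ε = 1 ∨ ε = -1) ∧ cl 1 = kummerClassOfPoint W K hp1 P ∧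
      (∀ n : ℕ, Squarefree n → (∀ q ∈ n.primeFactors, IsKolyvaginPrime (W.conductorNorm ℤ) W K (p ^ 1) q) →
        conjAct W c ((p ^ 1 : ℕ) : ℤ) (cl n) = (ε * (-1) ^ n.primeFactors.card) • cl n ∧
        (∀ v : HeightOneSpectrum (𝓞 K), (n : 𝓞 K) ∉ v.asIdeal →
          cl n ∈ selmerLocalKer (W.baseChange K) (v.adicCompletion K) ((p ^ 1 : ℕ) : ℤ)) ∧
        (∀ w : InfinitePlace K, cl n ∈ selmerLocalKer (W.baseChange K) w.Completion ((p ^ 1 : ℕ) : ℤ)) ∧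
        (∀ ℓ : ℕ, ℓ.Prime → ℓ ∣ n → ∀ v : HeightOneSpectrum (𝓞 K), (ℓ : 𝓞 K) ∈ v.asIdeal →
          (cl n ∈ selmerLocalKer (W.baseChange K) (v.adicCompletion K) ((p ^ 1 : ℕ) : ℤ) ↔
            cl (n / ℓ) ∈ (W.baseChange K).torsionLocalKer (v.adicCompletion K) ((p ^ 1 : ℕ) : ℤ)))) ∧
      ∃ n : ℕ, Squarefree n ∧ (∀ q ∈ n.primeFactors, Zhang2014.IsKolyvaginPrime (W.conductorNorm ℤ) W K p q) ∧
        (∀ q ∈ n.primeFactors, ∀ ℓ ∈ T, (ℓ : ℕ) ≠ q) ∧ n.primeFactors.card ≤ 2 ∧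
        ∃ w : HeightOneSpectrum (𝓞 K), ((p : ℕ) : 𝓞 K) ∈ w.asIdeal ∧
          cl n ∉ (W.baseChange K).torsionLocalKer (w.adicCompletion K) ((p ^ 1 : ℕ) : ℤ) := by
  have hp : p.Prime := Fact.out
  have hCM : ¬ W.HasCM := fun hCM ↦ W.not_hasSurjectiveModNGaloisRep_of_hasCM hCM hp (by omega) hsurj
  have hD : NumberField.discr K ≠ -3 ∧ NumberField.discr K ≠ -4 := ⟨by omega, by omega⟩
  have hp12 : p ^ 1 ≠ 2 := by rw [pow_one]; exact hp2
  have hρ : W.HasSurjectiveModNGaloisRep (p ^ 1) := by simpa using hsurj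
  obtain ⟨ε, cl, hε, hcl1, hcl⟩ := hGr hCM hK hD hH hP hp1 hp12 hρ c hc
  -- Gross's properties for square-free products of ZHANG–Kolyvagin primes (a Zhang prime is a Gross prime at the level `p¹`)
  have hZG : ∀ n : ℕ, (∀ q ∈ n.primeFactors, Zhang2014.IsKolyvaginPrime (W.conductorNorm ℤ) W K p q) →
      ∀ q ∈ n.primeFactors, IsKolyvaginPrime (W.conductorNorm ℤ) W K (p ^ 1) q := fun n hn q hq ↦
    isKolyvaginPrime_pow_one_of_zhang W K p hK hp2 hsurj (hn q hq)
  have h1 : cl 1 ≠ 0 := by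
    rw [hcl1]
    exact kummerClassOfPoint_ne_zero W K hp1 (by rw [pow_one]; exact hdiv)
  obtain ⟨n, hsq, hKP, hT, hcard, w, -, hpw, hwn⟩ :=
    exists_not_mem_torsionLocalKer_above_of_kolyvaginFamily_of_poitouTate W K p c hK hp2 hsurj hc hPT cl ε hε
      (fun n hn hZ ↦ (hcl n hn (hZG n hZ)).1) (fun n hn hZ ↦ (hcl n hn (hZG n hZ)).2.1)
      (fun n hn hZ ↦ (hcl n hn (hZG n hZ)).2.2.1) (fun n hn hZ ↦ (hcl n hn (hZG n hZ)).2.2.2) h1 v₀ hpv₀ T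
  exact ⟨ε, cl, hε, hcl1, hcl, n, hsq, hKP, hT, hcard, w, hpw, hwn⟩

end Supply

/-! ## §5 Input-free forms (DUAL.2 is the tree theorem `poitouTate_selmerStructure_duality_holds`) -/

section Free

open Summit.BirchSwinnertonDyer.BirchSwinnertonDyer.Theorems.SchneiderFreeAdditiveX3.PoitouTateReduction
  (poitouTate_selmerStructure_duality_holds)

variable (W : WeierstrassCurve ℚ) (K : Type) [Field K] [NumberField K] (p : ℕ) [Fact p.Prime] (c : K ≃ₐ[ℚ] K)

/-- **The visible `p`-relaxed eigen-partner, INPUT-FREE** (`exists_eigen_partner_detected_of_poitouTate` with DUAL.2 discharged by the tree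
theorem `poitouTate_selmerStructure_duality_holds`): for `K` imaginary quadratic, `p` odd and a place `v₀ ∋ p`, an eigenclass of `H¹(K, E[p])`
Kummer at `∞` and off `{v₀, c • v₀}`, with non-zero localisation at `v₀`. [cite: MilneADT2006, Ch. I, Thm. 2.8, Thm. 4.10] -/
theorem exists_eigen_partner_detected [W.IsElliptic] (hK : IsImaginaryQuadratic K) (hp2 : p ≠ 2)
    (v₀ : HeightOneSpectrum (𝓞 K)) (hpv₀ : ((p : ℕ) : 𝓞 K) ∈ v₀.asIdeal) :
    ∃ (s : Bool) (r : Vp W K p), conjAct W c ((p ^ 1 : ℕ) : ℤ) r = sgnP s • r ∧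
      (∀ w : InfinitePlace K, r ∈ selmerLocalKer (W.baseChange K) w.Completion ((p ^ 1 : ℕ) : ℤ)) ∧
      (∀ v : HeightOneSpectrum (𝓞 K), v ∉ ({v₀, c • v₀} : Finset (HeightOneSpectrum (𝓞 K))) →
        r ∈ selmerLocalKer (W.baseChange K) (v.adicCompletion K) ((p ^ 1 : ℕ) : ℤ)) ∧
      r ∉ (W.baseChange K).torsionLocalKer (v₀.adicCompletion K) ((p ^ 1 : ℕ) : ℤ) :=
  exists_eigen_partner_detected_of_poitouTate W K p c hK hp2 (poitouTate_selmerStructure_duality_holds K) v₀ hpv₀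

variable [W.IsElliptic] [W.IsGloballyMinimal] [NeZero (W.conductorNorm ℤ)]

/-- **THE LEVER, INPUT-FREE** — `exists_not_mem_torsionLocalKer_above_of_kolyvaginFamily_of_poitouTate` with DUAL.2 discharged by the tree theorem
`poitouTate_selmerStructure_duality_holds`: for `K` imaginary quadratic, `p` odd, `ρ̄_{E,p}` onto, `c ≠ 1` (any reduction type at `p`), a family
`cl` with Gross's three properties on square-free products of Zhang–Kolyvagin primes and `cl 1 ≠ 0`, and a place `v₀ ∋ p`: some `cl n`
(`n ∈ {1, ℓ, ℓ₁ℓ₂}` square-free, Zhang–Kolyvagin support avoiding `T`) has non-zero localisation at `v₀` or at `c • v₀`.  NO named fact.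
[cite: GrossLMS1991, Prop. 5.4, Prop. 6.2, §9] [cite: McCallumLMS1991, §3 Cor. 3.2] [cite: MilneADT2006, Ch. I, Thm. 4.10] -/
theorem exists_not_mem_torsionLocalKer_above_of_kolyvaginFamily_free (hK : IsImaginaryQuadratic K) (hp2 : p ≠ 2)
    (hsurj : W.HasSurjectiveModNGaloisRep p) (hc : c ≠ 1)
    (cl : ℕ → Vp W K p) (ε : ℤ) (hε : ε = 1 ∨ ε = -1)
    (hsign : ∀ n : ℕ, Squarefree n → (∀ q ∈ n.primeFactors, Zhang2014.IsKolyvaginPrime (W.conductorNorm ℤ) W K p q) →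
      conjAct W c ((p ^ 1 : ℕ) : ℤ) (cl n) = (ε * (-1) ^ n.primeFactors.card) • cl n)
    (hfin : ∀ n : ℕ, Squarefree n → (∀ q ∈ n.primeFactors, Zhang2014.IsKolyvaginPrime (W.conductorNorm ℤ) W K p q) →
      ∀ v : HeightOneSpectrum (𝓞 K), (n : 𝓞 K) ∉ v.asIdeal →
        cl n ∈ selmerLocalKer (W.baseChange K) (v.adicCompletion K) ((p ^ 1 : ℕ) : ℤ))
    (hinf : ∀ n : ℕ, Squarefree n → (∀ q ∈ n.primeFactors, Zhang2014.IsKolyvaginPrime (W.conductorNorm ℤ) W K p q) →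
      ∀ w : InfinitePlace K, cl n ∈ selmerLocalKer (W.baseChange K) w.Completion ((p ^ 1 : ℕ) : ℤ))
    (hrel : ∀ n : ℕ, Squarefree n → (∀ q ∈ n.primeFactors, Zhang2014.IsKolyvaginPrime (W.conductorNorm ℤ) W K p q) →
      ∀ ℓ : ℕ, ℓ.Prime → ℓ ∣ n → ∀ v : HeightOneSpectrum (𝓞 K), (ℓ : 𝓞 K) ∈ v.asIdeal →
        (cl n ∈ selmerLocalKer (W.baseChange K) (v.adicCompletion K) ((p ^ 1 : ℕ) : ℤ) ↔
          cl (n / ℓ) ∈ (W.baseChange K).torsionLocalKer (v.adicCompletion K) ((p ^ 1 : ℕ) : ℤ)))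
    (h1 : cl 1 ≠ 0) (v₀ : HeightOneSpectrum (𝓞 K)) (hpv₀ : ((p : ℕ) : 𝓞 K) ∈ v₀.asIdeal)
    (T : Finset {ℓ // Zhang2014.IsKolyvaginPrime (W.conductorNorm ℤ) W K p ℓ}) :
    ∃ n : ℕ, Squarefree n ∧ (∀ q ∈ n.primeFactors, Zhang2014.IsKolyvaginPrime (W.conductorNorm ℤ) W K p q) ∧
      (∀ q ∈ n.primeFactors, ∀ ℓ ∈ T, (ℓ : ℕ) ≠ q) ∧ n.primeFactors.card ≤ 2 ∧
      ∃ w ∈ ({v₀, c • v₀} : Finset (HeightOneSpectrum (𝓞 K))), ((p : ℕ) : 𝓞 K) ∈ w.asIdeal ∧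
        cl n ∉ (W.baseChange K).torsionLocalKer (w.adicCompletion K) ((p ^ 1 : ℕ) : ℤ) :=
  exists_not_mem_torsionLocalKer_above_of_kolyvaginFamily_of_poitouTate W K p c hK hp2 hsurj hc (poitouTate_selmerStructure_duality_holds K)
    cl ε hε hsign hfin hinf hrel h1 v₀ hpv₀ T

/-- **THE LEVER FOR GROSS'S KOLYVAGIN CLASSES, modulo `Gross1991_kolyvaginClasses` ALONE** (`exists_grossKolyvaginClass_detected_above_of_facts` with
DUAL.2 discharged by `poitouTate_selmerStructure_duality_holds`): `E/ℚ` with `ρ̄_{E,p}` onto (`p` odd), `K` imaginary quadratic with `d_K < −4`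
satisfying the Heegner hypothesis for `N_E`, `P = y_K` a Heegner point with `¬ ∃ Q, p • Q = P`, `c ≠ 1`, `v₀ ∋ p`: GRANTED Gross 1991 §§3–6
(`Gross1991_kolyvaginClasses N_E W K`, a leaf of the route's `kolyvagin`), Gross's family (printed properties at level `p¹`) has a member `c(n)`,
`n ∈ {1, ℓ, ℓ₁ℓ₂}` square-free of Zhang–Kolyvagin support avoiding `T`, with NON-ZERO localisation at a place above `p`.  CONDITIONAL on that one
named fact; any reduction type of `E` at `p`. [cite: GrossLMS1991, §4 (4.4), Prop. 5.4, Prop. 6.2, §9] [cite: McCallumLMS1991, §3 Cor. 3.2] -/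
theorem exists_grossKolyvaginClass_detected_above_of_grossClasses (hGr : Gross1991_kolyvaginClasses (W.conductorNorm ℤ) W K)
    (hK : IsImaginaryQuadratic K) (hd : NumberField.discr K < -4) (hH : SatisfiesHeegnerHypothesis (W.conductorNorm ℤ) K)
    {P : (W.baseChange K).toAffine.Point} (hP : IsHeegnerPoint (W.conductorNorm ℤ) W K P) (hp1 : Nat.Prime (p ^ 1)) (hp2 : p ≠ 2)
    (hsurj : W.HasSurjectiveModNGaloisRep p) (hc : c ≠ 1) (hdiv : ¬ ∃ Q : (W.baseChange K).toAffine.Point, p • Q = P)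
    (v₀ : HeightOneSpectrum (𝓞 K)) (hpv₀ : ((p : ℕ) : 𝓞 K) ∈ v₀.asIdeal)
    (T : Finset {ℓ // Zhang2014.IsKolyvaginPrime (W.conductorNorm ℤ) W K p ℓ}) :
    ∃ (ε : ℤ) (cl : ℕ → Vp W K p), (ε = 1 ∨ ε = -1) ∧ cl 1 = kummerClassOfPoint W K hp1 P ∧
      (∀ n : ℕ, Squarefree n → (∀ q ∈ n.primeFactors, IsKolyvaginPrime (W.conductorNorm ℤ) W K (p ^ 1) q) →
        conjAct W c ((p ^ 1 : ℕ) : ℤ) (cl n) = (ε * (-1) ^ n.primeFactors.card) • cl n ∧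
        (∀ v : HeightOneSpectrum (𝓞 K), (n : 𝓞 K) ∉ v.asIdeal →
          cl n ∈ selmerLocalKer (W.baseChange K) (v.adicCompletion K) ((p ^ 1 : ℕ) : ℤ)) ∧
        (∀ w : InfinitePlace K, cl n ∈ selmerLocalKer (W.baseChange K) w.Completion ((p ^ 1 : ℕ) : ℤ)) ∧
        (∀ ℓ : ℕ, ℓ.Prime → ℓ ∣ n → ∀ v : HeightOneSpectrum (𝓞 K), (ℓ : 𝓞 K) ∈ v.asIdeal →
          (cl n ∈ selmerLocalKer (W.baseChange K) (v.adicCompletion K) ((p ^ 1 : ℕ) : ℤ) ↔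
            cl (n / ℓ) ∈ (W.baseChange K).torsionLocalKer (v.adicCompletion K) ((p ^ 1 : ℕ) : ℤ)))) ∧
      ∃ n : ℕ, Squarefree n ∧ (∀ q ∈ n.primeFactors, Zhang2014.IsKolyvaginPrime (W.conductorNorm ℤ) W K p q) ∧
        (∀ q ∈ n.primeFactors, ∀ ℓ ∈ T, (ℓ : ℕ) ≠ q) ∧ n.primeFactors.card ≤ 2 ∧
        ∃ w : HeightOneSpectrum (𝓞 K), ((p : ℕ) : 𝓞 K) ∈ w.asIdeal ∧
          cl n ∉ (W.baseChange K).torsionLocalKer (w.adicCompletion K) ((p ^ 1 : ℕ) : ℤ) :=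
  exists_grossKolyvaginClass_detected_above_of_facts W K p c hGr (poitouTate_selmerStructure_duality_holds K) hK hd hH hP hp1 hp2 hsurj hc
    hdiv v₀ hpv₀ T

end Free

end Summit.BirchSwinnertonDyer.BirchSwinnertonDyer.Theorems.AdditiveKoly

end
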